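import Literature.NumberTheory.EllipticCurves.PadicLogEulerOperatorLiftProofs
import Literature.NumberTheory.EllipticCurves.FormalGroupDivision
import HarnessLib

/-!
# The index half of the lattice lemma: the Euler lattice `{y : (φ² − a_pφ + p)y ∈ p𝒪_w}` lies in
# `log_ω E(L_w)` when `E(L_w)[p] = 0`, granted its index (cell `bsd-addord`, W2, item 20397)

`Proofs` file (theorems only) in topic `NumberTheory/EllipticCurves`, namespace
`Literature.NumberTheory.EllipticCurves.EulerLattice`; sequel of `PadicLogEulerOperatorProofs`
(`⊆`: `(φ² − a_pφ + p)·log_ω E(L_w) ⊆ p𝒪_w`) and `PadicLogEulerOperatorLiftProofs` (Hensel lift,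
`p²𝒪_w ⊆ log_ω E₁`, the reduction homomorphism).  Setting as there: `W/ℚ` globally minimal with
`p ∤ Δ_min(W)`, `L : Type` a number field, `w ∋ p` UNRAMIFIED (`‖x‖ < 1 ⇒ ‖x‖ ≤ ‖p‖`), `K = L_w`,
`φ` an isometric `ℚ`-algebra endomorphism of `K` lifting `x ↦ x^p`, `log_ω = padicLogPointFiniteExt`
for the norm valuation on `W ⊗ L_w`.

* `exists_logHom` — `log_ω` as an additive homomorphism `E(L_w) →+ L_w` (every point has a
  multiple in the level under good reduction);
* `exists_padicLog_eq_of_mem_eulerLattice` — **if `E(L_w)` has no `p`-torsion and the Euler lattice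
  `Λ = {y : ‖φφy − a_p·φy + p·y‖ ≤ ‖p‖}` has index `[Λ : p𝒪_w] = #Ẽ(k_w)[p^∞]`, then every
  `y ∈ Λ` is `log_ω P` for some `P ∈ E(L_w)`** — with `norm_frobeniusCombination_padicLog_le` this is
  `log_ω E(L_w) = Λ`, i.e. `log_ω(E(K) ⊗ ℤ_p) = E_p(φ)⁻¹ · 𝒪_K` for unramified `K` with
  `E(K)[p] = 0` (Bloch–Kato, Example 3.11; the lattice the good-ANOMALOUS rows of the cell need, where
  `a_p ≡ 1 (mod p)` makes `Λ ⊋ p𝒪_K`).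

The INDEX HYPOTHESIS `hΛ` is the value computed by
`Summits/…/Theorems/KimAtThreeEulerLatticeIndex.relIndex_integer_eulerLattice` (`[Λ₁ : 𝒪_K] =
p^{v_p(p^f + 1 − D_f(a_p;p))}` in the base-`p` re-normed currency) with
`EulerLatticeReductionCountProofs.natCard_point_reduction_model` (`#Ẽ(k_w) = p^f + 1 − D_f(a_p;p)`);
its transport to this file's norm on `L_w` is left to the consumer (the sets `{‖x‖ ≤ 1}`, `E₁`,
the levels and `log_ω` coincide for the two equivalent norms).

## The count (proof of `exists_padicLog_eq_of_mem_eulerLattice`)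

`G := red⁻¹(Ẽ(k_w)[p^∞])` (`red : E(L_w) ↠ Ẽ(k_w)`, kernel `E₁`), `U₂ := U_{‖p‖²} ≤ E₁ ≤ G`,
`B₂ = p²𝒪_w ≤ B₁ = p𝒪_w ≤ Λ`.  Then: `log_ω G ≤ Λ` (the `⊆` half); `log_ω U₂ = B₂` (successive
approximation + `‖ℓ‖ ≤ ‖z‖`); `log_ω` is injective on `G` (a point of `G` with `log_ω = 0` is torsion,
`p^a`-times it lies in `E₁`, `p^{a+1}`-times in the torsion-free `U₂`, so it is killed by a power of
`p`, hence is `O` as `E(L_w)[p] = 0`); `[G : U₂] = [G : E₁]·[E₁ : U₂] = #Ẽ[p^∞]·[B₁ : B₂]`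
(`index_ker`; `relIndex_kernelLevel_eq` with the Hensel lift); so
`[log_ω G : B₂] = [G : U₂] = #Ẽ[p^∞]·[B₁ : B₂] = [Λ : B₁]·[B₁ : B₂] = [Λ : B₂]`, and `log_ω G ≤ Λ`
forces `log_ω G = Λ` (`relIndex_mul_relIndex`, `relIndex_eq_one`).

## References

* [BlochKato1990] S. Bloch, K. Kato (1990), §3, Example 3.11 (`A(K) ⊗ ℤ_p = H¹_f`, the lattice of
  the exponential for good reduction).
* [SilvermanAEC2009] J. H. Silverman, *AEC* 2nd ed. (2009): Thm. IV.6.4, Prop. IV.3.2, VII.2.1–2.2,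
  VII.3.1, Thm. V.2.3.1.
-/
noncomputable section

open scoped Classical NNReal NumberField

namespace Literature.NumberTheory.EllipticCurves.EulerLattice

open NumberField IsDedekindDomain _root_.WeierstrassCurve Literature.NumberTheory.EllipticCurves
  Literature.NumberTheory.EllipticCurves.FormalGroupChart

variable {L : Type} [Field L] [NumberField L] (w : HeightOneSpectrum (𝓞 L))
  (W : WeierstrassCurve ℚ) [W.IsElliptic] [W.IsGloballyMinimal] {p : ℕ} [hp : Fact p.Prime]

omit [W.IsElliptic] in
/-- `log_ω` as an additive homomorphism on all of `E(L_w)` (every point has a multiple in the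
level under good reduction). [cite: SilvermanAEC2009, Thm. IV.6.4(a) with Prop. VII.2.1–2.2] -/
theorem exists_logHom (hw : ((p : ℕ) : 𝓞 L) ∈ w.asIdeal) (hΔ : ¬ (p : ℤ) ∣ minimalDiscriminantInt W)
    (hdisc : ∀ x : w.adicCompletion L, ‖x‖ < 1 → ‖x‖ ≤ ‖(p : w.adicCompletion L)‖) :
    haveI := isIntegral_baseChange w W
    ∃ lg : (W.baseChange (w.adicCompletion L)).toAffine.Point →+ w.adicCompletion L,
      ∀ P, lg P = padicLogPointFiniteExt (NormedField.valuation : Valuation (w.adicCompletion L) ℝ≥0)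
        (W.baseChange (w.adicCompletion L)) p P := by
  haveI hint := isIntegral_baseChange w W
  have hp1 : (NormedField.valuation : Valuation (w.adicCompletion L) ℝ≥0) (p : w.adicCompletion L) < 1 :=
    LocalPoints.valuation_natCast_lt_one w hw
  have hp0 : (p : w.adicCompletion L) ≠ 0 := by
    rw [← map_natCast (algebraMap L (w.adicCompletion L)) p]
    exact (map_ne_zero _).mpr (Nat.cast_ne_zero.mpr hp.out.ne_zero)
  have hℓ := limitLog_spec_baseChange w W hw
  have hdisc' : ∀ x : w.adicCompletion L,
      (NormedField.valuation : Valuation (w.adicCompletion L) ℝ≥0) x < 1 →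
        (NormedField.valuation : Valuation (w.adicCompletion L) ℝ≥0) x ≤
          (NormedField.valuation : Valuation (w.adicCompletion L) ℝ≥0) (p : w.adicCompletion L) := by
    intro x hx
    rw [LocalPoints.valuation_apply, ← NNReal.coe_lt_coe, coe_nnnorm, NNReal.coe_one] at hx
    rw [LocalPoints.valuation_apply, LocalPoints.valuation_apply, ← NNReal.coe_le_coe, coe_nnnorm, coe_nnnorm]
    exact hdisc x hx
  have hlevel := level_val_natCast_eq_kernel (V := W.baseChange (w.adicCompletion L)) (p := p) hdisc'
  have hmult : ∀ P : (W.baseChange (w.adicCompletion L)).toAffine.Point, ∃ m : ℕ, 0 < m ∧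
      m • P ∈ level (NormedField.valuation : Valuation (w.adicCompletion L) ℝ≥0)
        (W.baseChange (w.adicCompletion L))
        ((NormedField.valuation : Valuation (w.adicCompletion L) ℝ≥0) (p : w.adicCompletion L)) := by
    intro P
    obtain ⟨m, hm, hmP⟩ := exists_nsmul_mem_kernel w W hw hΔ P
    exact ⟨m, hm, by rw [hlevel]; exact hmP⟩
  refine ⟨{ toFun := fun P => padicLogPointFiniteExt (NormedField.valuation : Valuation (w.adicCompletion L) ℝ≥0)
              (W.baseChange (w.adicCompletion L)) p P
            map_zero' := padicLogPointFiniteExt_zero hp0 hp1 hℓ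
            map_add' := fun P Q => by
              obtain ⟨m, hm, hmP⟩ := hmult P
              obtain ⟨n, hn, hnQ⟩ := hmult Q
              exact padicLogPointFiniteExt_add hp0 hp1 hℓ hm hmP hn hnQ }, fun P => rfl⟩

/-- **The Euler lattice is contained in `log_ω E(L_w)` when `E(L_w)[p] = 0`, granted its index.**
Setting of `norm_frobeniusCombination_padicLog_le` (unramified `w ∣ p`, `p ∤ Δ_min(W)`, `φ` an
isometric lift of `x ↦ x^p`), plus: no `p`-torsion in `E(L_w)` and the INDEX HYPOTHESIS
`hΛ : [Λ : p𝒪_w] = #Ẽ(k_w)[p^∞]` for the Euler lattice `Λ = {y : ‖φφy − a_pφy + py‖ ≤ ‖p‖}`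
(supplied by `Theorems/KimAtThreeEulerLatticeIndex.relIndex_integer_eulerLattice` with
`EulerLatticeReductionCountProofs.natCard_point_reduction_model`, through the base-`p` re-normed
synonym of `L_w`).  Then every `y ∈ Λ` is `log_ω P` for some `P ∈ E(L_w)`.  Proof (counting): for
`G = red⁻¹(Ẽ(k_w)[p^∞])`, `log_ω` is injective on `G` (no `p`-torsion; `U_{|p|²}` is torsion-free),
`log_ω U_{|p|²} = p²𝒪_w`, `[G : U_{|p|²}] = #Ẽ[p^∞]·[E₁ : U_{|p|²}] = #Ẽ[p^∞]·[p𝒪_w : p²𝒪_w]`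
(`relIndex_kernelLevel_eq`), so `[log_ω G : p²𝒪_w] = [Λ : p²𝒪_w]` with `log_ω G ≤ Λ`
(`norm_frobeniusCombination_padicLog_le`), whence `log_ω G = Λ`.
[cite: BlochKato1990, Example 3.11] [cite: SilvermanAEC2009, Thm. IV.6.4, Prop. VII.2.1–2.2, Thm. V.2.3.1] -/
theorem exists_padicLog_eq_of_mem_eulerLattice (hw : ((p : ℕ) : 𝓞 L) ∈ w.asIdeal)
    (hΔ : ¬ (p : ℤ) ∣ minimalDiscriminantInt W)
    (hdisc : ∀ x : w.adicCompletion L, ‖x‖ < 1 → ‖x‖ ≤ ‖(p : w.adicCompletion L)‖)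
    (φ : w.adicCompletion L →ₐ[ℚ] w.adicCompletion L) (hφ : ∀ x, ‖φ x‖ = ‖x‖)
    (hφp : ∀ x : w.adicCompletion L, ‖x‖ ≤ 1 → ‖φ x - x ^ p‖ < 1)
    [hint : (W.baseChange (w.adicCompletion L)).IsIntegral (NormedField.valuation : Valuation (w.adicCompletion L) ℝ≥0).integer]
    (hT : ∀ P : (W.baseChange (w.adicCompletion L)).toAffine.Point, p • P = 0 → P = 0)
    (Λ : AddSubgroup (w.adicCompletion L))
    (hΛmem : ∀ y, y ∈ Λ ↔ ‖φ (φ y) - (W.frobeniusTrace p : w.adicCompletion L) * φ y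
        + (p : w.adicCompletion L) * y‖ ≤ ‖(p : w.adicCompletion L)‖)
    (hΛ : ((NormedField.valuation : Valuation (w.adicCompletion L) ℝ≥0).leAddSubgroup ((NormedField.valuation : Valuation (w.adicCompletion L) ℝ≥0) (p : w.adicCompletion L))).relIndex Λ = Nat.card (AddCommGroup.primaryComponent (((integralModelInt W).map (Int.castRingHom (w.adicCompletionIntegers L))).map (IsLocalRing.residue (w.adicCompletionIntegers L))).toAffine.Point p))
    {y : w.adicCompletion L} (hy : y ∈ Λ) :
    ∃ P : (W.baseChange (w.adicCompletion L)).toAffine.Point, padicLogPointFiniteExt (NormedField.valuation : Valuation (w.adicCompletion L) ℝ≥0) (W.baseChange (w.adicCompletion L)) p P = y := by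
  classical
  haveI hint' := isIntegral_baseChange w W
  haveI := finite_point_reduction_model w W
  obtain ⟨red, hred, hredker⟩ := exists_reductionHom w W hw hΔ
  have hp1 : (NormedField.valuation : Valuation (w.adicCompletion L) ℝ≥0) (p : w.adicCompletion L) < 1 := LocalPoints.valuation_natCast_lt_one w hw
  have hp0 : (p : w.adicCompletion L) ≠ 0 := by
    rw [← map_natCast (algebraMap L (w.adicCompletion L)) p]
    exact (map_ne_zero _).mpr (Nat.cast_ne_zero.mpr hp.out.ne_zero)
  have hpv0 : 0 < (NormedField.valuation : Valuation (w.adicCompletion L) ℝ≥0) (p : w.adicCompletion L) := (Valuation.pos_iff _).mpr hp0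
  have hℓ := limitLog_spec_baseChange w W hw
  have hdisc' : ∀ x : w.adicCompletion L, (NormedField.valuation : Valuation (w.adicCompletion L) ℝ≥0) x < 1 → (NormedField.valuation : Valuation (w.adicCompletion L) ℝ≥0) x ≤ (NormedField.valuation : Valuation (w.adicCompletion L) ℝ≥0) (p : w.adicCompletion L) := by
    intro x hx
    rw [LocalPoints.valuation_apply, ← NNReal.coe_lt_coe, coe_nnnorm, NNReal.coe_one] at hx
    rw [LocalPoints.valuation_apply, LocalPoints.valuation_apply, ← NNReal.coe_le_coe, coe_nnnorm, coe_nnnorm]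
    exact hdisc x hx
  have hlevel := level_val_natCast_eq_kernel (V := (W.baseChange (w.adicCompletion L))) (p := p) hdisc'
  obtain ⟨lg, hlg⟩ := exists_logHom w W hw hΔ hdisc
  -- (c) `U₂ ≤ E₁ ≤ G`, `B₂ ≤ B₁ ≤ Λ`
  have hU₂E₁ : (kernelLevel (NormedField.valuation : Valuation (w.adicCompletion L) ℝ≥0) (W.baseChange (w.adicCompletion L)) ((NormedField.valuation : Valuation (w.adicCompletion L) ℝ≥0) (p : w.adicCompletion L) ^ 2)) ≤ (kernel (NormedField.valuation : Valuation (w.adicCompletion L) ℝ≥0) (W.baseChange (w.adicCompletion L))) := kernelLevel_le_kernel _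
  have hE₁G : (kernel (NormedField.valuation : Valuation (w.adicCompletion L) ℝ≥0) (W.baseChange (w.adicCompletion L))) ≤ ((AddCommGroup.primaryComponent (((integralModelInt W).map (Int.castRingHom (w.adicCompletionIntegers L))).map (IsLocalRing.residue (w.adicCompletionIntegers L))).toAffine.Point p).comap red) := by
    intro P hP
    rw [AddSubgroup.mem_comap, (hredker P).mpr hP]
    exact AddSubgroup.zero_mem _
  have hU₂G : (kernelLevel (NormedField.valuation : Valuation (w.adicCompletion L) ℝ≥0) (W.baseChange (w.adicCompletion L)) ((NormedField.valuation : Valuation (w.adicCompletion L) ℝ≥0) (p : w.adicCompletion L) ^ 2)) ≤ ((AddCommGroup.primaryComponent (((integralModelInt W).map (Int.castRingHom (w.adicCompletionIntegers L))).map (IsLocalRing.residue (w.adicCompletionIntegers L))).toAffine.Point p).comap red) := hU₂E₁.trans hE₁G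
  have hB₂B₁ : ((NormedField.valuation : Valuation (w.adicCompletion L) ℝ≥0).leAddSubgroup ((NormedField.valuation : Valuation (w.adicCompletion L) ℝ≥0) (p : w.adicCompletion L) ^ 2)) ≤ ((NormedField.valuation : Valuation (w.adicCompletion L) ℝ≥0).leAddSubgroup ((NormedField.valuation : Valuation (w.adicCompletion L) ℝ≥0) (p : w.adicCompletion L))) := by
    intro x hx
    rw [Valuation.mem_leAddSubgroup_iff] at hx ⊢
    exact hx.trans (by rw [pow_two]; exact mul_le_of_le_one_left' hp1.le)
  have hB₁Λ : ((NormedField.valuation : Valuation (w.adicCompletion L) ℝ≥0).leAddSubgroup ((NormedField.valuation : Valuation (w.adicCompletion L) ℝ≥0) (p : w.adicCompletion L))) ≤ Λ := by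
    intro x hx
    rw [Valuation.mem_leAddSubgroup_iff, LocalPoints.valuation_apply, LocalPoints.valuation_apply,
      ← NNReal.coe_le_coe, coe_nnnorm, coe_nnnorm] at hx
    rw [hΛmem]
    have ha : ‖(W.frobeniusTrace p : w.adicCompletion L)‖ ≤ 1 := IsUltrametricDist.norm_intCast_le_one _ _
    have hpn : ‖(p : w.adicCompletion L)‖ ≤ 1 := IsUltrametricDist.norm_natCast_le_one _ _
    have h1 : ‖φ (φ x)‖ ≤ ‖(p : w.adicCompletion L)‖ := by rw [hφ, hφ]; exact hx
    have h2 : ‖(W.frobeniusTrace p : w.adicCompletion L) * φ x‖ ≤ ‖(p : w.adicCompletion L)‖ := by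
      rw [norm_mul, hφ]; exact (mul_le_of_le_one_left (norm_nonneg _) ha).trans hx
    have h3 : ‖(p : w.adicCompletion L) * x‖ ≤ ‖(p : w.adicCompletion L)‖ := by
      rw [norm_mul]; exact mul_le_of_le_one_right (norm_nonneg _) (hx.trans hpn)
    refine (IsUltrametricDist.norm_add_le_max _ _).trans (max_le ?_ h3)
    rw [sub_eq_add_neg]
    exact (IsUltrametricDist.norm_add_le_max _ _).trans (max_le h1 (by rw [norm_neg]; exact h2))
  -- (a) `lg G ≤ Λ` (Frobenius annihilation + integrality on the level)
  have hGΛ : ((AddCommGroup.primaryComponent (((integralModelInt W).map (Int.castRingHom (w.adicCompletionIntegers L))).map (IsLocalRing.residue (w.adicCompletionIntegers L))).toAffine.Point p).comap red).map lg ≤ Λ := by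
    rintro _ ⟨P, -, rfl⟩
    rw [hΛmem, hlg]
    exact norm_frobeniusCombination_padicLog_le w W hw hΔ hdisc φ hφ hφp P
  -- (b) `lg(U₂) = B₂`
  have hU₂B₂ : (kernelLevel (NormedField.valuation : Valuation (w.adicCompletion L) ℝ≥0) (W.baseChange (w.adicCompletion L)) ((NormedField.valuation : Valuation (w.adicCompletion L) ℝ≥0) (p : w.adicCompletion L) ^ 2)).map lg = ((NormedField.valuation : Valuation (w.adicCompletion L) ℝ≥0).leAddSubgroup ((NormedField.valuation : Valuation (w.adicCompletion L) ℝ≥0) (p : w.adicCompletion L) ^ 2)) := by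
    ext x
    constructor
    · rintro ⟨Q, hQ, rfl⟩
      have hQ' := (mem_kernelLevel_iff (w := (NormedField.valuation : Valuation (w.adicCompletion L) ℝ≥0)) (V := (W.baseChange (w.adicCompletion L)))).mp hQ
      have hQlev : Q ∈ level (NormedField.valuation : Valuation (w.adicCompletion L) ℝ≥0) (W.baseChange (w.adicCompletion L)) ((NormedField.valuation : Valuation (w.adicCompletion L) ℝ≥0) (p : w.adicCompletion L)) :=
        ⟨hQ'.1, hQ'.2.trans (by rw [pow_two]; exact mul_le_of_le_one_left' hp1.le)⟩
      rw [Valuation.mem_leAddSubgroup_iff, hlg, padicLogPointFiniteExt_eq_limitLog hp0 hp1 hℓ hQlev]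
      exact (val_limitLog_le hp0 hp1 hℓ hQlev).trans hQ'.2
    · intro hx
      rw [Valuation.mem_leAddSubgroup_iff] at hx
      have hx' : ‖x‖ ≤ ‖(p : w.adicCompletion L)‖ ^ 2 := by
        rw [LocalPoints.valuation_apply, LocalPoints.valuation_apply, ← NNReal.coe_le_coe, coe_nnnorm,
          NNReal.coe_pow, coe_nnnorm] at hx
        exact hx
      obtain ⟨Q, hQK, hQz, hQx⟩ := exists_padicLog_eq_of_norm_le_sq w W hw hx'
      refine ⟨Q, (mem_kernelLevel_iff (w := (NormedField.valuation : Valuation (w.adicCompletion L) ℝ≥0)) (V := (W.baseChange (w.adicCompletion L)))).mpr ⟨hQK, ?_⟩, ?_⟩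
      · rw [LocalPoints.valuation_apply, LocalPoints.valuation_apply, ← NNReal.coe_le_coe, coe_nnnorm,
          NNReal.coe_pow, coe_nnnorm]
        exact hQz
      · rw [hlg]; exact hQx
  -- (d) `lg` is injective on `G`
  have hunit : ∀ n : ℕ, ¬ p ∣ n → (NormedField.valuation : Valuation (w.adicCompletion L) ℝ≥0) (n : w.adicCompletion L) = 1 := by
    intro n hn
    have h := valuation_intCast_eq_one_of_not_dvd w hw (n := (n : ℤ)) (by exact_mod_cast hn)
    rw [Int.cast_natCast] at h
    exact h
  have hU₂tf : ∀ Q ∈ (kernelLevel (NormedField.valuation : Valuation (w.adicCompletion L) ℝ≥0) (W.baseChange (w.adicCompletion L)) ((NormedField.valuation : Valuation (w.adicCompletion L) ℝ≥0) (p : w.adicCompletion L) ^ 2)), ∀ n : ℕ, n ≠ 0 → n • Q = 0 → Q = 0 := by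
    intro Q hQ n hn hnQ
    have hQ' := (mem_kernelLevel_iff (w := (NormedField.valuation : Valuation (w.adicCompletion L) ℝ≥0)) (V := (W.baseChange (w.adicCompletion L)))).mp hQ
    -- `CharZero` locally (a global instance would switch `Algebra ℚ L_w` to `DivisionRing.toRatAlgebra`)
    haveI : CharZero (w.adicCompletion L) :=
      charZero_of_injective_algebraMap (algebraMap L (w.adicCompletion L)).injective
    exact eq_zero_of_nsmul_eq_zero hp.out hunit hn hQ'.1
      (hQ'.2.trans_lt (by rw [pow_two]; exact mul_lt_of_lt_one_left hpv0 hp1)) hnQ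
  have hpE₁ : ∀ Q ∈ (kernel (NormedField.valuation : Valuation (w.adicCompletion L) ℝ≥0) (W.baseChange (w.adicCompletion L))), p • Q ∈ (kernelLevel (NormedField.valuation : Valuation (w.adicCompletion L) ℝ≥0) (W.baseChange (w.adicCompletion L)) ((NormedField.valuation : Valuation (w.adicCompletion L) ℝ≥0) (p : w.adicCompletion L) ^ 2)) := by
    intro Q hQ
    have h := val_zCoord_nsmul (w := (NormedField.valuation : Valuation (w.adicCompletion L) ℝ≥0)) (V := (W.baseChange (w.adicCompletion L))) p hQ
    refine (mem_kernelLevel_iff (w := (NormedField.valuation : Valuation (w.adicCompletion L) ℝ≥0)) (V := (W.baseChange (w.adicCompletion L)))).mpr ⟨h.1, ?_⟩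
    have hz1 : (NormedField.valuation : Valuation (w.adicCompletion L) ℝ≥0) Q.zCoord ≤ (NormedField.valuation : Valuation (w.adicCompletion L) ℝ≥0) (p : w.adicCompletion L) := by
      have hQl : Q ∈ level (NormedField.valuation : Valuation (w.adicCompletion L) ℝ≥0) (W.baseChange (w.adicCompletion L)) ((NormedField.valuation : Valuation (w.adicCompletion L) ℝ≥0) (p : w.adicCompletion L)) := by rw [hlevel]; exact hQ
      exact hQl.2
    have e : (p • Q).zCoord = ((p • Q).zCoord - (p : w.adicCompletion L) * Q.zCoord)
        + (p : w.adicCompletion L) * Q.zCoord := by ring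
    rw [e]
    refine (Valuation.map_add _ _ _).trans (max_le (h.2.2.trans ?_) ?_)
    · rw [pow_two, pow_two]; exact mul_le_mul' hz1 hz1
    · rw [Valuation.map_mul, pow_two]; exact mul_le_mul' le_rfl hz1
  have hpow_tors : ∀ (k : ℕ) (P : (W.baseChange (w.adicCompletion L)).toAffine.Point), p ^ k • P = 0 → P = 0 := by
    intro k
    induction k with
    | zero => intro P h; rwa [pow_zero, one_smul] at h
    | succ k ih =>
      intro P h
      have h' : p ^ k • (p • P) = 0 := by rwa [smul_smul, ← pow_succ]
      exact hT P (ih (p • P) h')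
  have hGtors : ∀ P ∈ ((AddCommGroup.primaryComponent (((integralModelInt W).map (Int.castRingHom (w.adicCompletionIntegers L))).map (IsLocalRing.residue (w.adicCompletionIntegers L))).toAffine.Point p).comap red), IsOfFinAddOrder P → P = 0 := by
    intro P hPG hfin
    have hPG' := AddSubgroup.mem_comap.mp hPG
    obtain ⟨a, ha⟩ := (AddCommGroup.mem_primaryComponent).mp hPG'
    have h1 : p ^ a • P ∈ (kernel (NormedField.valuation : Valuation (w.adicCompletion L) ℝ≥0) (W.baseChange (w.adicCompletion L))) := by
      rw [← hredker, map_nsmul]; exact ha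
    have h2 : p ^ (a + 1) • P ∈ (kernelLevel (NormedField.valuation : Valuation (w.adicCompletion L) ℝ≥0) (W.baseChange (w.adicCompletion L)) ((NormedField.valuation : Valuation (w.adicCompletion L) ℝ≥0) (p : w.adicCompletion L) ^ 2)) := by
      have e : p ^ (a + 1) • P = p • (p ^ a • P) := by rw [smul_smul, ← pow_succ']
      rw [e]
      exact hpE₁ _ h1
    obtain ⟨m, hm, hmP⟩ := (isOfFinAddOrder_iff_nsmul_eq_zero).mp hfin
    have h3 : m • (p ^ (a + 1) • P) = 0 := by rw [smul_comm, hmP, smul_zero]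
    have h4 : p ^ (a + 1) • P = 0 := hU₂tf _ h2 m hm.ne' h3
    exact hpow_tors _ P h4
  have hinjG : ∀ P ∈ ((AddCommGroup.primaryComponent (((integralModelInt W).map (Int.castRingHom (w.adicCompletionIntegers L))).map (IsLocalRing.residue (w.adicCompletionIntegers L))).toAffine.Point p).comap red), lg P = 0 → P = 0 := by
    intro P hPG h0
    obtain ⟨m, hm, hmP⟩ := exists_nsmul_mem_kernel w W hw hΔ P
    have hmP' : m • P ∈ level (NormedField.valuation : Valuation (w.adicCompletion L) ℝ≥0) (W.baseChange (w.adicCompletion L)) ((NormedField.valuation : Valuation (w.adicCompletion L) ℝ≥0) (p : w.adicCompletion L)) := by rw [hlevel]; exact hmP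
    rw [hlg, padicLogPointFiniteExt_eq_zero_iff hp0 hp1 hℓ hm hmP'] at h0
    exact hGtors P hPG h0
  -- (e) `[G : U₂] = [B₁ : B₂] · #Ẽ[p^∞]`
  have hE₁lev : kernelLevel (NormedField.valuation : Valuation (w.adicCompletion L) ℝ≥0) (W.baseChange (w.adicCompletion L)) ((NormedField.valuation : Valuation (w.adicCompletion L) ℝ≥0) (p : w.adicCompletion L)) = (kernel (NormedField.valuation : Valuation (w.adicCompletion L) ℝ≥0) (W.baseChange (w.adicCompletion L))) := by
    refine le_antisymm (kernelLevel_le_kernel _) fun P hP => ?_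
    exact (mem_kernelLevel_iff (w := (NormedField.valuation : Valuation (w.adicCompletion L) ℝ≥0)) (V := (W.baseChange (w.adicCompletion L)))).mpr ⟨hP, hdisc' _ (val_zCoord_lt_one hP)⟩
  have hlift : ∀ a : w.adicCompletion L, (NormedField.valuation : Valuation (w.adicCompletion L) ℝ≥0) a ≤ (NormedField.valuation : Valuation (w.adicCompletion L) ℝ≥0) (p : w.adicCompletion L) →
      ∃ P ∈ kernel (NormedField.valuation : Valuation (w.adicCompletion L) ℝ≥0) (W.baseChange (w.adicCompletion L)), P.zCoord = a :=
    fun a ha => exists_mem_kernel_zCoord_eq w W (ha.trans_lt hp1)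
  have hU₂E₁idx : (kernelLevel (NormedField.valuation : Valuation (w.adicCompletion L) ℝ≥0) (W.baseChange (w.adicCompletion L)) ((NormedField.valuation : Valuation (w.adicCompletion L) ℝ≥0) (p : w.adicCompletion L) ^ 2)).relIndex (kernel (NormedField.valuation : Valuation (w.adicCompletion L) ℝ≥0) (W.baseChange (w.adicCompletion L))) = ((NormedField.valuation : Valuation (w.adicCompletion L) ℝ≥0).leAddSubgroup ((NormedField.valuation : Valuation (w.adicCompletion L) ℝ≥0) (p : w.adicCompletion L) ^ 2)).relIndex ((NormedField.valuation : Valuation (w.adicCompletion L) ℝ≥0).leAddSubgroup ((NormedField.valuation : Valuation (w.adicCompletion L) ℝ≥0) (p : w.adicCompletion L))) := by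
    rw [← hE₁lev]
    exact relIndex_kernelLevel_eq (w := (NormedField.valuation : Valuation (w.adicCompletion L) ℝ≥0)) (V := (W.baseChange (w.adicCompletion L))) hlift
  have hE₁Gidx : (kernel (NormedField.valuation : Valuation (w.adicCompletion L) ℝ≥0) (W.baseChange (w.adicCompletion L))).relIndex ((AddCommGroup.primaryComponent (((integralModelInt W).map (Int.castRingHom (w.adicCompletionIntegers L))).map (IsLocalRing.residue (w.adicCompletionIntegers L))).toAffine.Point p).comap red) = Nat.card (AddCommGroup.primaryComponent (((integralModelInt W).map (Int.castRingHom (w.adicCompletionIntegers L))).map (IsLocalRing.residue (w.adicCompletionIntegers L))).toAffine.Point p) := by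
    have hrange : (red.comp ((AddCommGroup.primaryComponent (((integralModelInt W).map (Int.castRingHom (w.adicCompletionIntegers L))).map (IsLocalRing.residue (w.adicCompletionIntegers L))).toAffine.Point p).comap red).subtype).range = (AddCommGroup.primaryComponent (((integralModelInt W).map (Int.castRingHom (w.adicCompletionIntegers L))).map (IsLocalRing.residue (w.adicCompletionIntegers L))).toAffine.Point p) := by
      ext t
      constructor
      · rintro ⟨P, rfl⟩
        exact AddSubgroup.mem_comap.mp P.2
      · intro ht
        obtain ⟨P, hP⟩ := hred t
        have hPG : P ∈ ((AddCommGroup.primaryComponent (((integralModelInt W).map (Int.castRingHom (w.adicCompletionIntegers L))).map (IsLocalRing.residue (w.adicCompletionIntegers L))).toAffine.Point p).comap red) := by rw [AddSubgroup.mem_comap, hP]; exact ht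
        exact ⟨⟨P, hPG⟩, hP⟩
    have hker : (red.comp ((AddCommGroup.primaryComponent (((integralModelInt W).map (Int.castRingHom (w.adicCompletionIntegers L))).map (IsLocalRing.residue (w.adicCompletionIntegers L))).toAffine.Point p).comap red).subtype).ker = (kernel (NormedField.valuation : Valuation (w.adicCompletion L) ℝ≥0) (W.baseChange (w.adicCompletion L))).addSubgroupOf ((AddCommGroup.primaryComponent (((integralModelInt W).map (Int.castRingHom (w.adicCompletionIntegers L))).map (IsLocalRing.residue (w.adicCompletionIntegers L))).toAffine.Point p).comap red) := by
      ext P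
      rw [AddMonoidHom.mem_ker, AddSubgroup.mem_addSubgroupOf]
      exact hredker P
    rw [AddSubgroup.relIndex, ← hker, AddSubgroup.index_ker, hrange]
  have hU₂Gidx : (kernelLevel (NormedField.valuation : Valuation (w.adicCompletion L) ℝ≥0) (W.baseChange (w.adicCompletion L)) ((NormedField.valuation : Valuation (w.adicCompletion L) ℝ≥0) (p : w.adicCompletion L) ^ 2)).relIndex ((AddCommGroup.primaryComponent (((integralModelInt W).map (Int.castRingHom (w.adicCompletionIntegers L))).map (IsLocalRing.residue (w.adicCompletionIntegers L))).toAffine.Point p).comap red) = ((NormedField.valuation : Valuation (w.adicCompletion L) ℝ≥0).leAddSubgroup ((NormedField.valuation : Valuation (w.adicCompletion L) ℝ≥0) (p : w.adicCompletion L) ^ 2)).relIndex ((NormedField.valuation : Valuation (w.adicCompletion L) ℝ≥0).leAddSubgroup ((NormedField.valuation : Valuation (w.adicCompletion L) ℝ≥0) (p : w.adicCompletion L))) * Nat.card (AddCommGroup.primaryComponent (((integralModelInt W).map (Int.castRingHom (w.adicCompletionIntegers L))).map (IsLocalRing.residue (w.adicCompletionIntegers L))).toAffine.Point p) := by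
    rw [← AddSubgroup.relIndex_mul_relIndex (kernelLevel (NormedField.valuation : Valuation (w.adicCompletion L) ℝ≥0) (W.baseChange (w.adicCompletion L)) ((NormedField.valuation : Valuation (w.adicCompletion L) ℝ≥0) (p : w.adicCompletion L) ^ 2)) (kernel (NormedField.valuation : Valuation (w.adicCompletion L) ℝ≥0) (W.baseChange (w.adicCompletion L))) ((AddCommGroup.primaryComponent (((integralModelInt W).map (Int.castRingHom (w.adicCompletionIntegers L))).map (IsLocalRing.residue (w.adicCompletionIntegers L))).toAffine.Point p).comap red) hU₂E₁ hE₁G, hU₂E₁idx, hE₁Gidx]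
  -- (f) `[lg G : B₂] = [G : U₂]` (`lg` is injective on `G`)
  have hfinj : Function.Injective (lg.comp ((AddCommGroup.primaryComponent (((integralModelInt W).map (Int.castRingHom (w.adicCompletionIntegers L))).map (IsLocalRing.residue (w.adicCompletionIntegers L))).toAffine.Point p).comap red).subtype) := by
    intro P Q hPQ
    have h : (lg.comp ((AddCommGroup.primaryComponent (((integralModelInt W).map (Int.castRingHom (w.adicCompletionIntegers L))).map (IsLocalRing.residue (w.adicCompletionIntegers L))).toAffine.Point p).comap red).subtype) (P - Q) = 0 := by rw [map_sub, hPQ, sub_self]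
    have h' : ((P - Q : ((AddCommGroup.primaryComponent (((integralModelInt W).map (Int.castRingHom (w.adicCompletionIntegers L))).map (IsLocalRing.residue (w.adicCompletionIntegers L))).toAffine.Point p).comap red)) : (W.baseChange (w.adicCompletion L)).toAffine.Point) = 0 := hinjG _ (P - Q).2 h
    exact sub_eq_zero.mp (ZeroMemClass.coe_eq_zero.mp h')
  have hmapU : ((kernelLevel (NormedField.valuation : Valuation (w.adicCompletion L) ℝ≥0) (W.baseChange (w.adicCompletion L)) ((NormedField.valuation : Valuation (w.adicCompletion L) ℝ≥0) (p : w.adicCompletion L) ^ 2)).addSubgroupOf ((AddCommGroup.primaryComponent (((integralModelInt W).map (Int.castRingHom (w.adicCompletionIntegers L))).map (IsLocalRing.residue (w.adicCompletionIntegers L))).toAffine.Point p).comap red)).map (lg.comp ((AddCommGroup.primaryComponent (((integralModelInt W).map (Int.castRingHom (w.adicCompletionIntegers L))).map (IsLocalRing.residue (w.adicCompletionIntegers L))).toAffine.Point p).comap red).subtype) = ((NormedField.valuation : Valuation (w.adicCompletion L) ℝ≥0).leAddSubgroup ((NormedField.valuation : Valuation (w.adicCompletion L) ℝ≥0) (p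 : w.adicCompletion L) ^ 2)) := by
    rw [← hU₂B₂, ← AddSubgroup.map_map, AddSubgroup.addSubgroupOf, AddSubgroup.map_comap_eq,
      AddSubgroup.range_subtype, inf_eq_right.mpr hU₂G]
  have hmapT : (⊤ : AddSubgroup ((AddCommGroup.primaryComponent (((integralModelInt W).map (Int.castRingHom (w.adicCompletionIntegers L))).map (IsLocalRing.residue (w.adicCompletionIntegers L))).toAffine.Point p).comap red)).map (lg.comp ((AddCommGroup.primaryComponent (((integralModelInt W).map (Int.castRingHom (w.adicCompletionIntegers L))).map (IsLocalRing.residue (w.adicCompletionIntegers L))).toAffine.Point p).comap red).subtype) = ((AddCommGroup.primaryComponent (((integralModelInt W).map (Int.castRingHom (w.adicCompletionIntegers L))).map (IsLocalRing.residue (w.adicCompletionIntegers L))).toAffine.Point p).comap red).map lg := by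
    rw [← AddSubgroup.map_map, ← AddMonoidHom.range_eq_map, AddSubgroup.range_subtype]
  have hlgGidx : ((NormedField.valuation : Valuation (w.adicCompletion L) ℝ≥0).leAddSubgroup ((NormedField.valuation : Valuation (w.adicCompletion L) ℝ≥0) (p : w.adicCompletion L) ^ 2)).relIndex (((AddCommGroup.primaryComponent (((integralModelInt W).map (Int.castRingHom (w.adicCompletionIntegers L))).map (IsLocalRing.residue (w.adicCompletionIntegers L))).toAffine.Point p).comap red).map lg) = ((NormedField.valuation : Valuation (w.adicCompletion L) ℝ≥0).leAddSubgroup ((NormedField.valuation : Valuation (w.adicCompletion L) ℝ≥0) (p : w.adicCompletion L) ^ 2)).relIndex ((NormedField.valuation : Valuation (w.adicCompletion L) ℝ≥0).leAddSubgroup ((NormedField.valuation : Valuation (w.adicCompletion L) ℝ≥0) (p : w.adicCompletion L))) * Nat.card (AddCommGroup.primaryComponent (((integralModelInt W).map (Int.castRingHom (w.adicCompletionIntegers L))).map (IsLocalRing.residue (w.adicCompletionIntegers L))).toAffine.Point p) := by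
    rw [← hU₂Gidx, ← hmapU, ← hmapT, AddSubgroup.relIndex_map_map_of_injective _ _ hfinj,
      AddSubgroup.relIndex_top_right, AddSubgroup.relIndex]
  -- (g) conclusion: `[Λ : B₂] = [lg G : B₂]` and `lg G ≤ Λ`, so `lg G = Λ`
  have hB₂G : ((NormedField.valuation : Valuation (w.adicCompletion L) ℝ≥0).leAddSubgroup ((NormedField.valuation : Valuation (w.adicCompletion L) ℝ≥0) (p : w.adicCompletion L) ^ 2)) ≤ ((AddCommGroup.primaryComponent (((integralModelInt W).map (Int.castRingHom (w.adicCompletionIntegers L))).map (IsLocalRing.residue (w.adicCompletionIntegers L))).toAffine.Point p).comap red).map lg := by rw [← hU₂B₂]; exact AddSubgroup.map_mono hU₂G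
  have hΛidx : ((NormedField.valuation : Valuation (w.adicCompletion L) ℝ≥0).leAddSubgroup ((NormedField.valuation : Valuation (w.adicCompletion L) ℝ≥0) (p : w.adicCompletion L) ^ 2)).relIndex Λ = ((NormedField.valuation : Valuation (w.adicCompletion L) ℝ≥0).leAddSubgroup ((NormedField.valuation : Valuation (w.adicCompletion L) ℝ≥0) (p : w.adicCompletion L) ^ 2)).relIndex ((NormedField.valuation : Valuation (w.adicCompletion L) ℝ≥0).leAddSubgroup ((NormedField.valuation : Valuation (w.adicCompletion L) ℝ≥0) (p : w.adicCompletion L))) * Nat.card (AddCommGroup.primaryComponent (((integralModelInt W).map (Int.castRingHom (w.adicCompletionIntegers L))).map (IsLocalRing.residue (w.adicCompletionIntegers L))).toAffine.Point p) := by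
    rw [← AddSubgroup.relIndex_mul_relIndex ((NormedField.valuation : Valuation (w.adicCompletion L) ℝ≥0).leAddSubgroup ((NormedField.valuation : Valuation (w.adicCompletion L) ℝ≥0) (p : w.adicCompletion L) ^ 2)) ((NormedField.valuation : Valuation (w.adicCompletion L) ℝ≥0).leAddSubgroup ((NormedField.valuation : Valuation (w.adicCompletion L) ℝ≥0) (p : w.adicCompletion L))) Λ hB₂B₁ hB₁Λ, hΛ]
  have hne : ((NormedField.valuation : Valuation (w.adicCompletion L) ℝ≥0).leAddSubgroup ((NormedField.valuation : Valuation (w.adicCompletion L) ℝ≥0) (p : w.adicCompletion L) ^ 2)).relIndex ((NormedField.valuation : Valuation (w.adicCompletion L) ℝ≥0).leAddSubgroup ((NormedField.valuation : Valuation (w.adicCompletion L) ℝ≥0) (p : w.adicCompletion L))) * Nat.card (AddCommGroup.primaryComponent (((integralModelInt W).map (Int.castRingHom (w.adicCompletionIntegers L))).map (IsLocalRing.residue (w.adicCompletionIntegers L))).toAffine.Point p) ≠ 0 := by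
    refine mul_ne_zero ?_ Nat.card_pos.ne'
    rw [LocalPoints.relIndex_leAddSubgroup_eq w hp0 hp.out.ne_zero rfl (by rw [pow_two])]
    exact LocalPoints.card_quotient_span_natCast_ne_zero w hp.out.ne_zero
  have hone : (((AddCommGroup.primaryComponent (((integralModelInt W).map (Int.castRingHom (w.adicCompletionIntegers L))).map (IsLocalRing.residue (w.adicCompletionIntegers L))).toAffine.Point p).comap red).map lg).relIndex Λ = 1 := by
    have h := AddSubgroup.relIndex_mul_relIndex ((NormedField.valuation : Valuation (w.adicCompletion L) ℝ≥0).leAddSubgroup ((NormedField.valuation : Valuation (w.adicCompletion L) ℝ≥0) (p : w.adicCompletion L) ^ 2)) (((AddCommGroup.primaryComponent (((integralModelInt W).map (Int.castRingHom (w.adicCompletionIntegers L))).map (IsLocalRing.residue (w.adicCompletionIntegers L))).toAffine.Point p).comap red).map lg) Λ hB₂G hGΛ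
    rw [hlgGidx, hΛidx] at h
    exact (mul_right_inj' hne).mp (h.trans (mul_one _).symm)
  have hΛG : Λ ≤ ((AddCommGroup.primaryComponent (((integralModelInt W).map (Int.castRingHom (w.adicCompletionIntegers L))).map (IsLocalRing.residue (w.adicCompletionIntegers L))).toAffine.Point p).comap red).map lg := AddSubgroup.relIndex_eq_one.mp hone
  obtain ⟨P, -, hP⟩ := hΛG hy
  exact ⟨P, by rw [← hlg]; exact hP⟩

end Literature.NumberTheory.EllipticCurves.EulerLattice
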